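import Mathlib
import Summits.Ventures.PercRepro2.Defs
import Summits.Ventures.PercRepro2.CoinKStarLattice
import Summits.Ventures.PercRepro2.CoinKStarTilt
import Summits.Ventures.PercRepro2.CoinKStarLaw

/-!
# The trace masses of a head with an ARBITRARY leaf-side law (blind cell PercRepro2, night-2 g5;
proofs/NIGHT2-DARC.md §27)

The k-star proof (§26) only uses that the leaf-side trace law is LOG-SUPERMODULAR, not that it is a
product.  `hA β q L = β L · armProd q L`, `hB β q L = β L · (1 − armProd q L)`, `hLam`, `hMass` are
the masses of §26.1 for an arbitrary `β : Finset V → R` (the trace law `L ↦ P(K⁻ ∩ P′ = L)` of the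
head minus `w`, e.g. of a pendant FOREST), with the dominations the abstract lemma needs when `β`
is nonnegative and log-supermodular; `kA = hA (leafLaw ..)` etc. recover the star.
-/

namespace Summit.Ventures.PercRepro2.Coin

section LsmHeadLaw

open Classical

variable {V : Type*} [Fintype V] [DecidableEq V] {R : Type*} [Field R] [LinearOrder R]
  [IsStrictOrderedRing R]


/-- The trace mass of `L` (`w ∉ K⁻`) for a general leaf-side law `β`. -/
def hA (β : Finset V → R) (q : V → R) (L : Finset V) : R := β L * armProd q L

/-- The trace mass of `L ∪ {w}` (`w ∈ K⁻`) for a general leaf-side law `β`. -/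
def hB (β : Finset V → R) (q : V → R) (L : Finset V) : R := β L * (1 - armProd q L)

/-- The total mass `Λ` for a general leaf-side law. -/
def hLam (Vs : Finset V) (β : Finset V → R) (q : V → R) (w : V) (F : Finset V → R) : R :=
  ∑ L ∈ Vs.powerset, (hA β q L * F L + hB β q L * F (insert w L))

/-- The avoided-marker mass for a general leaf-side law. -/
def hMass (Vs : Finset V) (β : Finset V → R) (q : V → R) (w : V) (G : Finset V → R) : R :=
  ∑ L ∈ Vs.powerset, (hA β q L * G L + hB β q L * G (insert w L))

omit [Fintype V] [LinearOrder R] [IsStrictOrderedRing R] in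
/-- `kA` is `hA` for the product law. -/
lemma kA_eq_hA (Vs : Finset V) (β q : V → R) : kA Vs β q = hA (leafLaw Vs β) q := rfl

omit [Fintype V] [LinearOrder R] [IsStrictOrderedRing R] in
/-- `kB` is `hB` for the product law. -/
lemma kB_eq_hB (Vs : Finset V) (β q : V → R) : kB Vs β q = hB (leafLaw Vs β) q := rfl

omit [Fintype V] [LinearOrder R] [IsStrictOrderedRing R] in
/-- `kLam` is `hLam` for the product law. -/
lemma kLam_eq_hLam (Vs : Finset V) (β q : V → R) (w : V) (F : Finset V → R) :
    kLam Vs β q w F = hLam Vs (leafLaw Vs β) q w F := rfl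

omit [Fintype V] [LinearOrder R] [IsStrictOrderedRing R] in
/-- `kMass` is `hMass` for the product law. -/
lemma kMass_eq_hMass (Vs : Finset V) (β q : V → R) (w : V) (G : Finset V → R) :
    kMass Vs β q w G = hMass Vs (leafLaw Vs β) q w G := rfl

omit [Fintype V] [DecidableEq V] in
/-- `hA` is nonnegative. -/
lemma hA_nonneg {Vs : Finset V} {β : Finset V → R} {q : V → R} (hβ0 : ∀ L ⊆ Vs, 0 ≤ β L)
    (hq0 : ∀ i ∈ Vs, 0 ≤ q i) {L : Finset V} (hL : L ⊆ Vs) : 0 ≤ hA β q L :=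
  mul_nonneg (hβ0 L hL) (armProd_nonneg hq0 hL)

omit [Fintype V] [DecidableEq V] in
/-- `hB` is nonnegative. -/
lemma hB_nonneg {Vs : Finset V} {β : Finset V → R} {q : V → R} (hβ0 : ∀ L ⊆ Vs, 0 ≤ β L)
    (hq0 : ∀ i ∈ Vs, 0 ≤ q i) (hq1 : ∀ i ∈ Vs, q i ≤ 1) {L : Finset V} (hL : L ⊆ Vs) :
    0 ≤ hB β q L :=
  mul_nonneg (hβ0 L hL) (by linarith [armProd_le_one hq0 hq1 hL])

omit [Fintype V] [DecidableEq V] in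
/-- `hA L ≤ β L`. -/
lemma hA_le_β {Vs : Finset V} {β : Finset V → R} {q : V → R} (hβ0 : ∀ L ⊆ Vs, 0 ≤ β L)
    (hq0 : ∀ i ∈ Vs, 0 ≤ q i) (hq1 : ∀ i ∈ Vs, q i ≤ 1) {L : Finset V} (hL : L ⊆ Vs) :
    hA β q L ≤ β L := by
  have := mul_le_mul_of_nonneg_left (armProd_le_one hq0 hq1 hL) (hβ0 L hL)
  simpa [hA] using this

omit [Fintype V] in
/-- `hA` is log-supermodular when `β` is. -/
lemma hA_mul_le {Vs : Finset V} {β : Finset V → R} {q : V → R}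
    (hβ : ∀ L L', L ⊆ Vs → L' ⊆ Vs → β L * β L' ≤ β (L ∩ L') * β (L ∪ L'))
    (hq0 : ∀ i ∈ Vs, 0 ≤ q i) {L L' : Finset V} (hL : L ⊆ Vs) (hL' : L' ⊆ Vs) :
    hA β q L * hA β q L' ≤ hA β q (L ∩ L') * hA β q (L ∪ L') := by
  simp only [hA]
  calc β L * armProd q L * (β L' * armProd q L')
      = (β L * β L') * (armProd q L * armProd q L') := by ring
    _ ≤ (β (L ∩ L') * β (L ∪ L')) * (armProd q (L ∩ L') * armProd q (L ∪ L')) := by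
        rw [armProd_mul]
        exact mul_le_mul_of_nonneg_right (hβ L L' hL hL')
          (mul_nonneg (armProd_nonneg hq0 (Finset.inter_subset_left.trans hL))
            (armProd_nonneg hq0 (Finset.union_subset hL hL')))
    _ = _ := by ring

omit [Fintype V] in
/-- `hA · hB` domination for a log-supermodular `β`. -/
lemma hA_mul_hB_le {Vs : Finset V} {β : Finset V → R} {q : V → R} (hβ0 : ∀ L ⊆ Vs, 0 ≤ β L)
    (hβ : ∀ L L', L ⊆ Vs → L' ⊆ Vs → β L * β L' ≤ β (L ∩ L') * β (L ∪ L'))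
    (hq0 : ∀ i ∈ Vs, 0 ≤ q i) (hq1 : ∀ i ∈ Vs, q i ≤ 1) {L L' : Finset V} (hL : L ⊆ Vs)
    (hL' : L' ⊆ Vs) : hA β q L * hB β q L' ≤ hA β q (L ∩ L') * hB β q (L ∪ L') := by
  simp only [hA, hB]
  have hpm := armProd_mul q L L'
  have hanti : armProd q L ≤ armProd q (L ∩ L') :=
    armProd_anti hq0 hq1 Finset.inter_subset_left hL
  have h0 : 0 ≤ β (L ∩ L') * β (L ∪ L') :=
    mul_nonneg (hβ0 _ (Finset.inter_subset_left.trans hL)) (hβ0 _ (Finset.union_subset hL hL'))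
  have hx0 : 0 ≤ armProd q L - armProd q L * armProd q L' := by
    have := armProd_nonneg hq0 hL
    have := armProd_le_one hq0 hq1 hL'
    have := armProd_nonneg hq0 hL'
    nlinarith
  calc β L * armProd q L * (β L' * (1 - armProd q L'))
      = (β L * β L') * (armProd q L - armProd q L * armProd q L') := by ring
    _ ≤ (β (L ∩ L') * β (L ∪ L')) * (armProd q L - armProd q L * armProd q L') :=
        mul_le_mul_of_nonneg_right (hβ L L' hL hL') hx0
    _ = (β (L ∩ L') * β (L ∪ L')) *
        (armProd q L - armProd q (L ∩ L') * armProd q (L ∪ L')) := by rw [hpm]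
    _ ≤ (β (L ∩ L') * β (L ∪ L')) *
        (armProd q (L ∩ L') - armProd q (L ∩ L') * armProd q (L ∪ L')) :=
        mul_le_mul_of_nonneg_left (by linarith) h0
    _ = β (L ∩ L') * armProd q (L ∩ L') *
        (β (L ∪ L') * (1 - armProd q (L ∪ L'))) := by ring

omit [Fintype V] in
/-- `hA · β` domination for a log-supermodular `β`. -/
lemma hA_mul_β_le {Vs : Finset V} {β : Finset V → R} {q : V → R} (hβ0 : ∀ L ⊆ Vs, 0 ≤ β L)
    (hβ : ∀ L L', L ⊆ Vs → L' ⊆ Vs → β L * β L' ≤ β (L ∩ L') * β (L ∪ L'))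
    (hq0 : ∀ i ∈ Vs, 0 ≤ q i) (hq1 : ∀ i ∈ Vs, q i ≤ 1) {L L' : Finset V} (hL : L ⊆ Vs)
    (hL' : L' ⊆ Vs) : hA β q L * β L' ≤ hA β q (L ∩ L') * β (L ∪ L') := by
  simp only [hA]
  have hanti : armProd q L ≤ armProd q (L ∩ L') :=
    armProd_anti hq0 hq1 Finset.inter_subset_left hL
  have h0 : 0 ≤ β (L ∩ L') * β (L ∪ L') :=
    mul_nonneg (hβ0 _ (Finset.inter_subset_left.trans hL)) (hβ0 _ (Finset.union_subset hL hL'))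
  calc β L * armProd q L * β L' = (β L * β L') * armProd q L := by ring
    _ ≤ (β (L ∩ L') * β (L ∪ L')) * armProd q L :=
        mul_le_mul_of_nonneg_right (hβ L L' hL hL') (armProd_nonneg hq0 hL)
    _ ≤ (β (L ∩ L') * β (L ∪ L')) * armProd q (L ∩ L') :=
        mul_le_mul_of_nonneg_left hanti h0
    _ = _ := by ring


end LsmHeadLaw

end Summit.Ventures.PercRepro2.Coin
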